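import Mathlib
import Summits.Ventures.FusionMHD.Models.CerfonFreidbergNstxLikeQHalfDefs
import HarnessLib

/-!
# Ventures/FusionMHD — Models/CerfonFreidbergNstxLikeQHalfPanels8.lean: KERNEL CHECK of panels 27, 28, 29 (of 32) of the
# certified interior safety factor `q(ψ_N = 1/2)/F` of THE Cerfon–Freidberg NSTX-like instance (twin of `…IterLikeQHalfPanels*.lean`)

HONEST FRAMING (LADDER-GRIDFUSION three columns; CF rung, F2 item R2, NSTX-like twin).  One `decide +kernel` (≈ 103 s on the farm): for
each panel `j` listed, the per-panel obligation `CFNstxLike.QHalf.PanelCert.ok` (`Models/CerfonFreidbergNstxLikeQHalfDefs.lean`) — the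
Taylor-model run of `CFNstxLike.QHalf.progG` over the NSTX-like parameter box is ACCEPTED (every `log`/`sin`/`cos` composition and the `inv`
certificate), and the kernel's panel-integral enclosure of the polar `(6.35)` integrand along the approximant, the range of the flux residual
`U(ray m) − U_a/2`, the range of the approximant `m` and the range of the radial derivative `D_r(θ, m)` lie inside the integers claimed in
`panelCert8` (values read off a compiled `#eval` of the same functions, slack one unit of `2⁻⁶⁰`; probe `QProbeNF*.lean`, generator
`pub/gridfusion/models/gen-model-5/g8/mkdefsN.py`).  What these Booleans MEAN (real-number statements, uniformly over the parameter box ∋ THE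
NSTX-like instance) is proved once in `Models/CerfonFreidbergNstxLikeQHalfSound.lean`.  MODELLED: analytic Cerfon–Freidberg family; `q` of a
MODEL surface — nothing about a device or stability.  No `native_decide`.  Typer/prover: gridfusion-model-5 (g8), 2026-08-27.
Citations: Freidberg 2014 §6.3.5 (6.35) [Freidberg2014]; Mahboubi–Melquiond–Sibut-Pinote 2016 §3.2 Lemma 3 [MahboubiMelquiondSibutpinote2016].
-/

namespace Summit.Ventures.FusionMHD.Models.CFNstxLike.QHalf

/-- The certificate data of panels 27, 28, 29 (NSTX-like): `inv` candidate (degree-12 fit of `(X·D_r)⁻¹` in the panel variable, scaled by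
`2⁶⁰`), Taylor degree, `inv` widening `2^elog2`, and the claimed integral / residual / `m`-range / `D_r`-range integers (× `2⁶⁰`). [instance data] -/
def panelCert8 : List PanelCert := [
  { j := 27, cand := [5548015918986156032, -5576832348477629440, 21236526524973817856, -3357353090485235200, -70534138858449575936, 525580539555244867584, -2108941403893340307456, 6983590036625698062336, -18927407264842972659712, 24990696112281503137792, -1821621735354900468989952, 24729328743609512736325632, 3092167070073465172601602048],
    deg := 10, elog2 := 31, plo := 328695188373701031, phi := 328695188657263922, eta := 11685163, mlo := 681841901970973778, mhi := 708549816947109775,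
    dlo := 324502817897052458, dhi := 338151456513849685 },
  { j := 28, cand := [5394322864850969600, -4265825155643673600, 20642622390295752704, -8124775220678620160, -12989209950339743744, 244980462306115944448, -1012823917948763897856, 3421794847843638312960, -10812652217920860979200, 43910794733764552425472, 2670503192416266567548928, -28482025048961595878670336, -3491998359018830458871873536],
    deg := 10, elog2 := 31, plo := 309535312637692029, phi := 309535312928515156, eta := 20286790, mlo := 663238644475090892, mhi := 683495977602662468,
    dlo := 337508554741696620, dhi := 348597763564224042 },
  { j := 29, cand := [5280920752622436352, -3000042678078606848, 19866995485461385216, -7874843509780652032, 13526695595115548672, 110844068867162324992, -483075407813582979072, 1632238062195040583680, -4014025289750643998720, -12931870345887150505984, -3460997535411686879526912, 37565789488304763938275328, 4565552635386210948822859776],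
    deg := 12, elog2 := 29, plo := 295889379683979600, phi := 295889379751135339, eta := 3513058, mlo := 650342929052676450, mhi := 664736405395395163,
    dlo := 347898274528091936, dhi := 356196955287200327 }]

/-- **KERNEL CHECK** of panels 27, 28, 29 of the NSTX-like surface `ψ_N = 1/2`. -/
theorem panelCert8_ok : CFNstxLike.QHalf.panelCert8.all PanelCert.ok = true := by
  decide +kernel

end Summit.Ventures.FusionMHD.Models.CFNstxLike.QHalf
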